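import Summits.ResolutionOfSingularities.ResolutionOfSingularities.Theorems.HilbertSamuelEliminationSigmaMaxModificationsCorridor3QuadricGapRing
import Summits.ResolutionOfSingularities.ResolutionOfSingularities.Theorems.HilbertSamuelEliminationSigmaMaxModificationsCorridor3TameThreeOfQuadricGap
import Mathlib.RingTheory.RegularLocalRing.Polynomial
import Mathlib.RingTheory.DedekindDomain.Basic
import Mathlib.RingTheory.FiniteType
import Mathlib.AlgebraicGeometry.Morphisms.FiniteType
import Mathlib.AlgebraicGeometry.Noetherian
import HarnessLib

/-!
# `SigmaMaxModificationsCorridor3` (stmt-19249), line `tame_wild`: the QUADRIC GAP (scheme level) and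
# the registered stub `stub_tameNu3` for `p ≤ 3`

[OURS · L1 W4.2] **Quadric gap:** on a reduced scheme locally of finite type over a field, of dimension `≤ 3`,
a non-regular point `y` with `H^3_Y(y) ≤ q := hypersurfaceHF 2` has `H^3_Y(y) = q` (`quadricGap`) — the local
rings are reduced quotients of regular local rings (localised polynomial rings, `exists_regular_presentation_stalk`),
so the ring-level gap `hilbertSamuelFun_eq_hypersurfaceHF_two_of_le` (p465186) applies. CONSEQUENCE
(`tameNu3_of_prime_le_three`, via the landed `tameNu3_of_prime_le_three_of_quadricGap`): **the registered
transfer stub `stub_tameNu3` of line `tame_wild` holds for every prime `p ≤ 3`** — vacuously: for `p = 2` there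
is no tame value, for `p = 3` the only tame value is the double-point value `q`, whose stratum is isolated from
the rest of the singular locus. Kernel form of the census line "in characteristic `2` and `3` every non-isolated
singular stratum of a threefold is wild" (CJS Rem. 6.29); the tame regime of the line is non-empty only for
`p ≥ 5`, where it carries the un-citable step H4 (order reduction of marked ideals in ambient dimension 3).
NOT a statement of any manuscript. [cite: CossartJannsenSaito2020, Def. 2.28, Lemma 2.23, Rem. 6.29]
-/

set_option linter.dupNamespace false -- mandated namespace of this single-conjunct summit

noncomputable section

open CategoryTheory AlgebraicGeometry TopologicalSpace Topology IsLocalRing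
open Literature.AlgebraicGeometry.Resolution Literature.RingTheory.HilbertSamuel

namespace Summit.ResolutionOfSingularities.ResolutionOfSingularities.Theorems.SigmaMaxModificationsCorridor3.TameWild

/-- **The local rings of a scheme locally of finite type over a field are quotients of regular local rings**
(localisations of polynomial rings at primes). [folklore] -/
theorem exists_regular_presentation_stalk {k : Type} [Field k] {Y : Scheme.{0}}
    (g : Y ⟶ Spec (.of k)) [LocallyOfFiniteType g] (y : Y) :
    ∃ (S : Type) (_ : CommRing S) (_ : IsRegularLocalRing S) (f : S →+* Y.presheaf.stalk y),
      Function.Surjective f := by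
  classical
  obtain ⟨U, hU, hyU, -⟩ :=
    exists_isAffineOpen_mem_and_subset (X := Y) (x := y) (U := ⊤) (Opens.mem_top y)
  -- `Γ(Y, U)` is a `k`-algebra of finite type
  let φ₀ : k →+* Γ(Y, U) := (g.appLE ⊤ U le_top).hom.comp (Scheme.ΓSpecIso (.of k)).inv.hom
  have hφ₀ : φ₀.FiniteType := by
    have h1 : (g.appLE ⊤ U le_top).hom.FiniteType :=
      HasRingHomProperty.appLE @LocallyOfFiniteType g inferInstance ⟨⊤, isAffineOpen_top _⟩ ⟨U, hU⟩
        le_top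
    exact h1.comp (RingHom.FiniteType.of_surjective _
      (Scheme.ΓSpecIso (.of k)).symm.commRingCatIsoToRingEquiv.surjective)
  letI : Algebra k Γ(Y, U) := φ₀.toAlgebra
  haveI : Algebra.FiniteType k Γ(Y, U) := hφ₀
  obtain ⟨n, ψ, hψ⟩ := Algebra.FiniteType.iff_quotient_mvPolynomial''.mp ‹Algebra.FiniteType k Γ(Y, U)›
  -- the stalk is the localisation of `Γ(Y, U)` at the prime of `y`
  letI : Algebra Γ(Y, U) (Y.presheaf.stalk y) :=
    TopCat.Presheaf.algebra_section_stalk Y.presheaf ⟨y, hyU⟩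
  let q : Ideal Γ(Y, U) := (hU.primeIdealOf ⟨y, hyU⟩).asIdeal
  haveI : IsLocalization.AtPrime (Y.presheaf.stalk y) q := hU.isLocalization_stalk ⟨y, hyU⟩
  -- pull back to the polynomial ring
  let Q : Ideal (MvPolynomial (Fin n) k) := q.comap ψ.toRingHom
  haveI : Q.IsPrime := Ideal.comap_isPrime _ _
  have hle : Q.primeCompl ≤ q.primeCompl.comap ψ.toRingHom := fun t ht => ht
  let f : Localization.AtPrime Q →+* Y.presheaf.stalk y :=
    IsLocalization.map (Y.presheaf.stalk y) ψ.toRingHom hle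
  refine ⟨Localization.AtPrime Q, inferInstance, inferInstance, f, ?_⟩
  intro z
  obtain ⟨⟨b, s⟩, rfl⟩ := IsLocalization.mk'_surjective q.primeCompl z
  obtain ⟨a, ha⟩ := hψ b
  obtain ⟨t, ht⟩ := hψ s
  have htQ : t ∈ Q.primeCompl := by
    show t ∉ Q
    intro htQ'
    have : (s : Γ(Y, U)) ∈ q := by rw [← ht]; exact htQ'
    exact s.2 this
  refine ⟨IsLocalization.mk' _ a ⟨t, htQ⟩, ?_⟩
  rw [IsLocalization.map_mk']
  congr 1
  all_goals first | exact ha | exact Subtype.ext ht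

/-- **THE QUADRIC GAP.** On a reduced scheme locally of finite type over a field with `dim Y ≤ 3`, a
non-regular point `y` with `H^3_Y(y) ≤ hypersurfaceHF 2` has `H^3_Y(y) = hypersurfaceHF 2` — the hypothesis
`hgap` of `tameNu3_three_of_quadricGap`, verbatim. [cite: CossartJannsenSaito2020, Def. 2.28, Lemma 2.23] -/
theorem quadricGap :
    ∀ (k : Type) [Field k] (Y : Scheme.{0}) (g : Y ⟶ Spec (.of k)), LocallyOfFiniteType g →
      QuasiCompact g → IsReduced Y → topologicalKrullDim Y ≤ ((3 : ℕ) : WithBot ℕ∞) →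
      ∀ y : Y, y ∉ Scheme.regularLocus Y → Scheme.hsFun Y 3 y ≤ hypersurfaceHF 2 →
        Scheme.hsFun Y 3 y = hypersurfaceHF 2 := by
  intro k _ Y g hft _ hred hdim y hreg hH
  haveI : IsLocallyNoetherian Y := LocallyOfFiniteType.isLocallyNoetherian g
  -- `dim 𝒪_{Y,y} = d ∈ ℕ`
  have hle : ringKrullDim (Y.presheaf.stalk y) ≤ ((3 : ℕ) : WithBot ℕ∞) :=
    (SigmaMaxModifications.Negative.ringKrullDim_stalk_le_topologicalKrullDim' Y y).trans hdim
  have hge : (0 : WithBot ℕ∞) ≤ ringKrullDim (Y.presheaf.stalk y) := ringKrullDim_nonneg_of_nontrivial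
  obtain ⟨d, hd⟩ := exists_nat_eq_of_ne_bot_of_ne_top
    (ne_bot_of_le_ne_bot WithBot.zero_ne_bot hge) (ne_top_of_le_ne_top (by decide) hle)
  obtain ⟨S, _, _, f, hf⟩ := exists_regular_presentation_stalk g y
  exact hilbertSamuelFun_eq_hypersurfaceHF_two_of_le f hf hd hreg hH

/-- **The registered stub `stub_tameNu3` of line `tame_wild` for every prime `p ≤ 3`** (`p = 2`: no tame value;
`p = 3`: the double-point stratum is isolated — quadric gap). The tame regime of the line is empty below `p = 5`.
[cite: CossartJannsenSaito2020, Rem. 6.29, Def. 6.14] -/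
theorem tameNu3_of_prime_le_three :
    ∀ p : ℕ, p.Prime → p ≤ 3 → ∀ (k : Type) [Field k] [CharP k p] [PerfectField k] (Y : Scheme.{0})
      (g : Y ⟶ Spec (.of k)), IsSeparated g → LocallyOfFiniteType g → QuasiCompact g →
      IsReduced Y → ((3 : ℕ) : WithBot ℕ∞) ≤ topologicalKrullDim Y →
      topologicalKrullDim Y ≤ ((3 : ℕ) : WithBot ℕ∞) →
      ∀ ν : ℕ → ℕ, Maximal (· ∈ Scheme.hsValues Y 3) ν → ν ≠ iterPSum 3 Phi →
        IsTameValue p ν →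
        ¬ Disjoint (closure ((Scheme.regularLocus Y)ᶜ \ Scheme.hsStratum Y 3 ν))
            (Scheme.hsStratum Y 3 ν) →
        NuMod Y 3 3 ν :=
  tameNu3_of_prime_le_three_of_quadricGap quadricGap

/-- The same at `p = 3` exactly (`[CharP k 3]`). [cite: CossartJannsenSaito2020, Rem. 6.29] -/
theorem tameNu3_three :
    ∀ (k : Type) [Field k] [CharP k 3] [PerfectField k] (Y : Scheme.{0})
      (g : Y ⟶ Spec (.of k)), IsSeparated g → LocallyOfFiniteType g → QuasiCompact g →
      IsReduced Y → ((3 : ℕ) : WithBot ℕ∞) ≤ topologicalKrullDim Y →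
      topologicalKrullDim Y ≤ ((3 : ℕ) : WithBot ℕ∞) →
      ∀ ν : ℕ → ℕ, Maximal (· ∈ Scheme.hsValues Y 3) ν → ν ≠ iterPSum 3 Phi →
        IsTameValue 3 ν →
        ¬ Disjoint (closure ((Scheme.regularLocus Y)ᶜ \ Scheme.hsStratum Y 3 ν))
            (Scheme.hsStratum Y 3 ν) →
        NuMod Y 3 3 ν :=
  tameNu3_three_of_quadricGap quadricGap

/-- **Isolation of a maximal double-point stratum** (scheme level, unconditional): on a reduced threefold of
finite type over a field, the stratum of the value `hypersurfaceHF 2` does not meet the closure of the rest of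
the singular locus. [cite: CossartJannsenSaito2020, Rem. 6.29] -/
theorem disjoint_closure_hsStratum_hypersurfaceHF_two {k : Type} [Field k] {Y : Scheme.{0}}
    (g : Y ⟶ Spec (.of k)) [LocallyOfFiniteType g] [QuasiCompact g] [IsReduced Y]
    (hdim : topologicalKrullDim Y ≤ ((3 : ℕ) : WithBot ℕ∞)) :
    Disjoint (closure ((Scheme.regularLocus Y)ᶜ \ Scheme.hsStratum Y 3 (hypersurfaceHF 2)))
      (Scheme.hsStratum Y 3 (hypersurfaceHF 2)) :=
  disjoint_closure_of_quadricGap g hdim (quadricGap k Y g inferInstance inferInstance inferInstance hdim)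

end Summit.ResolutionOfSingularities.ResolutionOfSingularities.Theorems.SigmaMaxModificationsCorridor3.TameWild

end
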